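import Summits.Ventures.PercRepro.C041ConeClass

/-!
# ROW C-041 — SUMMARY of the six-vector form (p6, gen 29): every end theorem restated with all its hypotheses in
the type (the referees' tree-read form)

* `row_C041_sixVec_glue` — Π is multiplicative over blocks at the anchor (C-041.md §20 (b)(3));
* `row_C041_sixVec_pendant` — THEOREM (PENDANT ZONE) in six-vector form (§20 (b));
* `row_C041_point_cone` — the marked point's six-vector lies in the cone (the seed);
* `row_C041_cone_class` — the ZONE O-CUBE on the class 𝒵 (point / pendant / glue / iso), and its (CS) form.
-/

namespace PercRepro

namespace ZoneZ

open ZoneData TreeClosure Pendant AnchorGlue PointZone Finset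

/-- Π is multiplicative over blocks at the anchor. -/
theorem row_C041_sixVec_glue {V₂ E₂ S₁ S₂ V₃ E₃ R₁ R₂ : Type*} [Fintype E₂] [DecidableEq E₂] [Fintype S₁]
    [DecidableEq S₁] [Fintype S₂] [DecidableEq S₂] [Fintype E₃] [DecidableEq E₃] [Fintype R₁] [DecidableEq R₁]
    [Fintype R₂] [DecidableEq R₂] (Z₂ : ZoneData V₂ E₂ S₁ S₂) (a₂ : V₂) (Z₃ : ZoneData V₃ E₃ R₁ R₂) (a₃ : V₃) :
    (glue Z₂ a₂ Z₃ a₃).sixVec (Sum.inl a₂) = Z₂.sixVec a₂ * Z₃.sixVec a₃ :=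
  sixVec_glue Z₂ a₂ Z₃ a₃

/-- THEOREM (PENDANT ZONE) in six-vector form: `Π(Z₁ ∪_u Z₂) = x·ℓ(ψΠ₂) + z·Π₂ + w·n′·𝟙`. -/
theorem row_C041_sixVec_pendant {V₁ E₁ U₁ U₂ V₂ E₂ T₁ T₂ : Type*} [Fintype E₁] [DecidableEq E₁] [Fintype E₂]
    [DecidableEq E₂] [Fintype T₁] [DecidableEq T₁] [Fintype T₂] [DecidableEq T₂] (Z₁ : ZoneData V₁ E₁ U₁ U₂)
    (u a : V₁) (Z₂ : ZoneData V₂ E₂ T₁ T₂) (a₂ : V₂) :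
    (pendant Z₁ u Z₂ a₂).sixVec (Sum.inl a) =
      (xCount Z₁ u a : ℝ) • ell (#(Z₂.Fset a₂)) (#(Z₂.T1set a₂)) (#(Z₂.T2set a₂)) (#(Z₂.Iset a₂)) +
        (zCount Z₁ u a : ℝ) • Z₂.sixVec a₂ + ((wCount Z₁ u a * #(Z₂.Aset (∅ : Set V₂)) : ℕ) : ℝ) • (1 : Vec6) :=
  sixVec_pendant Z₁ u Z₂ a₂ a

/-- The marked point's six-vector lies in the cone. -/
theorem row_C041_point_cone (p q : ℕ) : InCone ((pointZone p q).sixVec ()) :=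
  inCone_sixVec_pointZone p q

/-- The ZONE O-CUBE on the class 𝒵 generated from marked points by pendant attachment, gluing at the anchor and
isomorphism. -/
theorem row_C041_cone_class {V E T₁ T₂ : Type} (Z : ZoneData V E T₁ T₂) (k : V) (h : IsZc Z k) [Fintype E]
    [DecidableEq E] [Fintype T₁] [DecidableEq T₁] [Fintype T₂] [DecidableEq T₂] :
    Z.ZoneOCubeConj {k} (∅ : Set V) :=
  h.zoneOCubeConj

/-- The one-anchor (CS) on the class 𝒵. -/
theorem row_C041_cone_class_cs {V E T₁ T₂ : Type} (Z : ZoneData V E T₁ T₂) (k : V) (h : IsZc Z k) [Fintype E]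
    [DecidableEq E] [Fintype T₁] [DecidableEq T₁] [Fintype T₂] [DecidableEq T₂] :
    Z.ZoneCSConj {k} (∅ : Set V) :=
  h.zoneCSConj

end ZoneZ

end PercRepro
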